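import Mathlib
import Literature.MathematicalPhysics.StatisticalMechanics.Crystallization
import Literature.MathematicalPhysics.StatisticalMechanics.CrystallizationLocalLimit

/-!
# The point set of a periodic configuration is a Delone set of finite local complexity

For a periodic configuration `P` of `ℝᵈ` (full-rank lattice `G`, finite motif `F`, point set
`Λ = F + G`, `PeriodicConfiguration`, Blanc–Lewin 2015 §2.1 (17)–(18)) we record the standard
facts, in the inlined phrasing used by the crystallization routes (no bundled `Delone` structure):

* `PeriodicConfiguration.sub_mem_points`, `PeriodicConfiguration.add_mem_points_iff` — lattice
  invariance of `Λ` both ways;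
* `PeriodicConfiguration.exists_forall_exists_dist_le` — `Λ` is relatively dense (covering
  radius: a bound on the fundamental domain of a `ℤ`-basis of `G`, `ZSpan.floor`/`ZSpan.fract`);
  uniform discreteness is `PeriodicConfiguration.exists_pos_le_dist` (file
  `CrystallizationLocalLimit`);
* `PeriodicConfiguration.exists_motif_patch_eq` — the patch `Λ − q` of a point `q = y + g`
  (`y ∈ F`, `g ∈ G`) is the patch `Λ − y` of its motif representative;
* `PeriodicConfiguration.finite_patches` — hence `Λ` has finite local complexity: for every `R`
  the `R`-patches `{v | x + v ∈ Λ, ‖v‖ ≤ R}`, `x ∈ Λ`, form a finite family;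
* `PeriodicConfiguration.forall_points_rebase` / `exists_points_rebase` — re-basing bounded
  quantifiers over `Λ` from `y + g` to `y` (the substitution `s ↦ s + g` is a bijection of `Λ` with
  `dist (s + g) (y + g) = dist s y`, `(s + g) − (y + g) = s − y`);
* `PeriodicConfiguration.exists_delone_flc` — the package "`Λ` is `δ`-separated, `r`-dense and FLC".

Sources: Baake–Grimm, *Aperiodic Order* I (2013), §2.1–2.2 (Delone sets, FLC; lattice-periodic
point sets are crystallographic, hence FLC); Blanc–Lewin 2015 §2.1. All proofs are elementary and
tagged `[folklore]`. Deliberately NOT here: the converse direction (FLC + full-rank periods ⇒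
periodic), hull/local-topology notions.
-/

noncomputable section

namespace Literature.MathematicalPhysics.StatisticalMechanics

namespace PeriodicConfiguration

variable {d : ℕ} (P : PeriodicConfiguration d)

/-- The point set of a periodic configuration is invariant under subtraction of a period.
[folklore] -/
theorem sub_mem_points {z g : EuclideanSpace ℝ (Fin d)} (hz : z ∈ P.points)
    (hg : g ∈ P.lattice) : z - g ∈ P.points := by
  simpa [sub_eq_add_neg] using P.add_mem_points hz (P.lattice.neg_mem hg)

/-- Lattice invariance of the point set, both ways: `z + g ∈ Λ ↔ z ∈ Λ` for a period `g`.
[folklore] -/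
theorem add_mem_points_iff {z g : EuclideanSpace ℝ (Fin d)} (hg : g ∈ P.lattice) :
    z + g ∈ P.points ↔ z ∈ P.points :=
  ⟨fun h => by simpa using P.sub_mem_points h hg, fun h => P.add_mem_points h hg⟩

/-- **Relative density** of the point set of a periodic configuration: there is `r > 0` such
that every point of space is within `r` of `Λ` (`r` = a bound on the fundamental domain of a
`ℤ`-basis of the lattice of periods, plus one; the witness is `y₀ + ⌊c − y₀⌋` for a motif point
`y₀`). [folklore] -/
theorem exists_forall_exists_dist_le :
    ∃ r : ℝ, 0 < r ∧ ∀ c : EuclideanSpace ℝ (Fin d), ∃ y ∈ P.points, dist y c ≤ r := by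
  haveI : Module.Finite ℤ P.lattice := ZLattice.module_finite ℝ P.lattice
  let b₀ := Module.Free.chooseBasis ℤ P.lattice
  let B := b₀.ofZLatticeBasis ℝ P.lattice
  obtain ⟨D, hD⟩ := (ZSpan.fundamentalDomain_isBounded B).exists_norm_le
  obtain ⟨y₀, hy₀⟩ := P.motif_nonempty
  refine ⟨|D| + 1, by positivity, fun z => ?_⟩
  have hfl : (ZSpan.floor B (z - y₀) : EuclideanSpace ℝ (Fin d)) ∈ P.lattice :=
    (b₀.ofZLatticeBasis_span ℝ (L := P.lattice)).le (ZSpan.floor B (z - y₀)).2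
  refine ⟨y₀ + ZSpan.floor B (z - y₀), ⟨y₀, hy₀, _, hfl, rfl⟩, ?_⟩
  have hfr := hD _ (ZSpan.fract_mem_fundamentalDomain B (z - y₀))
  rw [ZSpan.fract_apply] at hfr
  calc dist (y₀ + (ZSpan.floor B (z - y₀) : EuclideanSpace ℝ (Fin d))) z
        = ‖z - y₀ - ZSpan.floor B (z - y₀)‖ := by
          rw [dist_comm, dist_eq_norm]; congr 1; abel
    _ ≤ D := hfr
    _ ≤ |D| + 1 := by linarith [le_abs_self D]

/-- **The patch of `Λ` at a point depends only on the point modulo the lattice**: every `q ∈ Λ`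
has a motif representative `y` with `q + v ∈ Λ ↔ y + v ∈ Λ` for all `v`. [folklore] -/
theorem exists_motif_patch_eq :
    ∀ q ∈ P.points, ∃ y ∈ P.motif, ∀ v : EuclideanSpace ℝ (Fin d),
      (q + v ∈ P.points ↔ y + v ∈ P.points) := by
  rintro q ⟨y, hy, g, hg, rfl⟩
  refine ⟨y, hy, fun v => ?_⟩
  rw [add_right_comm, P.add_mem_points_iff hg]

/-- The same, set form: `Λ − q = Λ − y` for the motif representative `y` of `q ∈ Λ`. [folklore] -/
theorem exists_motif_patch_eq' :
    ∀ q ∈ P.points, ∃ y ∈ P.motif,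
      {v : EuclideanSpace ℝ (Fin d) | ∃ s ∈ P.points, s - q = v} =
        {v : EuclideanSpace ℝ (Fin d) | ∃ s ∈ P.points, s - y = v} := by
  intro q hq
  obtain ⟨y, hy, h⟩ := P.exists_motif_patch_eq q hq
  refine ⟨y, hy, Set.ext fun v => ?_⟩
  simp only [Set.mem_setOf_eq, sub_eq_iff_eq_add, exists_eq_right, add_comm v]
  exact h v

/-- **Finite local complexity** of the point set of a periodic configuration: for every `R` the
`R`-patches `{v | x + v ∈ Λ, ‖v‖ ≤ R}`, `x ∈ Λ`, form a finite family (they are among the patches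
at the finitely many motif points). [folklore] -/
theorem finite_patches :
    ∀ R : ℝ, Set.Finite {S : Set (EuclideanSpace ℝ (Fin d)) |
      ∃ x ∈ P.points, S = {v : EuclideanSpace ℝ (Fin d) | x + v ∈ P.points ∧ ‖v‖ ≤ R}} := by
  intro R
  refine ((P.motif.finite_toSet.image fun y =>
    {v : EuclideanSpace ℝ (Fin d) | y + v ∈ P.points ∧ ‖v‖ ≤ R}).subset ?_)
  rintro S ⟨x, hx, rfl⟩
  obtain ⟨y, hy, h⟩ := P.exists_motif_patch_eq x hx
  refine ⟨y, hy, Set.ext fun v => ?_⟩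
  simp only [Set.mem_setOf_eq, h v]

/-- Bounded universal quantifiers over `Λ` are invariant under the substitution `s ↦ s + g`,
`g` a period. [folklore] -/
theorem forall_points_comp_add {g : EuclideanSpace ℝ (Fin d)} (hg : g ∈ P.lattice)
    (p : EuclideanSpace ℝ (Fin d) → Prop) :
    (∀ s ∈ P.points, p s) ↔ (∀ s ∈ P.points, p (s + g)) := by
  refine ⟨fun h s hs => h (s + g) (P.add_mem_points hs hg), fun h s hs => ?_⟩
  have := h (s - g) (P.sub_mem_points hs hg)
  rwa [sub_add_cancel] at this

/-- Bounded existential quantifiers over `Λ` are invariant under the substitution `s ↦ s + g`,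
`g` a period. [folklore] -/
theorem exists_points_comp_add {g : EuclideanSpace ℝ (Fin d)} (hg : g ∈ P.lattice)
    (p : EuclideanSpace ℝ (Fin d) → Prop) :
    (∃ s ∈ P.points, p s) ↔ (∃ s ∈ P.points, p (s + g)) := by
  refine ⟨fun ⟨s, hs, hps⟩ => ⟨s - g, P.sub_mem_points hs hg, by rwa [sub_add_cancel]⟩,
    fun ⟨s, hs, hps⟩ => ⟨s + g, P.add_mem_points hs hg, hps⟩⟩

/-- **Re-basing a universal matching clause** from `q = y + g` to `y` (`g` a period):
`∀ s ∈ Λ, Φ (dist s q) (s − q)` iff `∀ s ∈ Λ, Φ (dist s y) (s − y)`. [folklore] -/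
theorem forall_points_rebase {y g : EuclideanSpace ℝ (Fin d)} (hg : g ∈ P.lattice)
    (Φ : ℝ → EuclideanSpace ℝ (Fin d) → Prop) :
    (∀ s ∈ P.points, Φ (dist s (y + g)) (s - (y + g))) ↔
      (∀ s ∈ P.points, Φ (dist s y) (s - y)) := by
  rw [P.forall_points_comp_add hg (fun s => Φ (dist s (y + g)) (s - (y + g)))]
  simp only [dist_add_right, add_sub_add_right_eq_sub]

/-- **Re-basing an existential matching clause** from `q = y + g` to `y` (`g` a period):
`∃ s ∈ Λ, Φ (s − q)` iff `∃ s ∈ Λ, Φ (s − y)`. [folklore] -/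
theorem exists_points_rebase {y g : EuclideanSpace ℝ (Fin d)} (hg : g ∈ P.lattice)
    (Φ : EuclideanSpace ℝ (Fin d) → Prop) :
    (∃ s ∈ P.points, Φ (s - (y + g))) ↔ (∃ s ∈ P.points, Φ (s - y)) := by
  rw [P.exists_points_comp_add hg (fun s => Φ (s - (y + g)))]
  simp only [add_sub_add_right_eq_sub]

/-- **The point set of a periodic configuration is an FLC Delone set**: it is `δ`-separated for
some `δ > 0`, `r`-dense for some `r > 0`, and has finitely many `R`-patches up to translation for
every `R`. [folklore] -/
theorem exists_delone_flc :
    ∃ δ r : ℝ, 0 < δ ∧ 0 < r ∧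
      (∀ x ∈ P.points, ∀ y ∈ P.points, x ≠ y → δ ≤ dist x y) ∧
      (∀ c : EuclideanSpace ℝ (Fin d), ∃ y ∈ P.points, dist y c ≤ r) ∧
      (∀ R : ℝ, Set.Finite {S : Set (EuclideanSpace ℝ (Fin d)) |
        ∃ x ∈ P.points, S = {v : EuclideanSpace ℝ (Fin d) | x + v ∈ P.points ∧ ‖v‖ ≤ R}}) := by
  obtain ⟨δ, hδ, hsep⟩ := P.exists_pos_le_dist
  obtain ⟨r, hr, hden⟩ := P.exists_forall_exists_dist_le
  exact ⟨δ, r, hδ, hr, hsep, hden, P.finite_patches⟩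

end PeriodicConfiguration

end Literature.MathematicalPhysics.StatisticalMechanics

end
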